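import Summits.RiemannHypothesis.RiemannHypothesis.Theorems.NymanBeurlingNbThesisZeroFloor
import Summits.RiemannHypothesis.RiemannHypothesis.Theorems.NymanBeurlingNbThesisIntegrable
import Literature.Barriers.RiemannHypothesis.TuranPartialSumsHolds
import Literature.Barriers.RiemannHypothesis.TuranPartialSumsLiouville
import Literature.Barriers.RiemannHypothesis.TuranPartialSumsInfinitude
import Literature.Barriers.RiemannHypothesis.TuranPartialSumsSpiraCriterion
import Literature.Barriers.RiemannHypothesis.TuranPartialSumsSpiraCertificates
import Mathlib.Tactic.Simproc.Factors
import Mathlib.Tactic.Simproc.FinsetInterval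
import Mathlib.Tactic.NormNum.Prime
import Mathlib.Tactic.NormNum.BigOperators
import HarnessLib

/-!
# Truncating `ζ` in the Nyman–Beurling distance is decided RH-free: `FIN_M ⟺ M ∈ {1, 2}` for EVERY
# `M` — the sections `ζ_M`, `M ≥ 3`, have zeros right of the critical line and each such zero puts a
# positive floor under all the truncated distances (NB-NEG, census axis V43 «ζ-TRUNCATION») — cell
# `rh-split`; raw quantified forms, ZERO defs; typed by rh-split-nb-neg g18

Family nb (Nyman–Beurling / Báez-Duarte), lens NEG, card
`run/shared/lean/pub/rh-split/cards/SPLIT-nb-neg.md` §24 (gen 18).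
`E_NB = Theses.NymanBeurling.NbThesis`
(`∀ ε > 0, ∃ N a, ∫⁻ ‖1 - ζ(1/2+it)·A_a(1/2+it)‖² dt/(1/4+t²) < ε`,
`A_a(s) = Σ_{n<N} a_n (n+1)^{-s}`), kernel `Theorems.nbThesis_iff_riemannHypothesis`.  V43 cuts
the `ζ`-AXIS of `E_NB`: keep the quantifiers, the weight, the line and the mollifier class, and
replace `ζ` by its `M`-th SECTION
`ζ_M(s) = Σ_{n ≤ M} n^{-s}` (tree `Literature.Barriers.RiemannHypothesis.zetaPartialSum`, the object
of Turán's 1948 programme and of the catalogued barrier `TuranPartialSums`):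
`FIN_M := ∀ ε > 0, ∃ N a, ∫⁻ ‖1 - ζ_M(1/2+it)·A_a(1/2+it)‖² dt/(1/4+t²) < ε`
(spelled verbatim below).

* §1 (the ZERO FLOOR, T44a `truncIntegrand_floor_of_zero`).  If `ζ_M(ρ) = 0` with `Re ρ > 1/2` then
  for EVERY `N, a`: `∫⁻ ‖1 - ζ_M A_a‖² dt/(1/4+t²) ≥ 4π(Re ρ - 1/2)²/(|ρ|²|ρ+1|²) > 0` — the
  Hardy-space point evaluation of `F(s) = (1 - ζ_M(s)A(s))(ρ+1)/((s+1)s)` at `ρ` (`F(ρ) = 1/ρ`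
  whatever `A` is), through the tree's `ofReal_norm_le_lintegral_line` and
  `nb_lintegral_kernel_sq_le` (the mechanism of `nbIntegrand_floor_of_zero` for `ζ` itself, Burnol's
  lower bound), with `|ζ_M| ≤ M` on `σ ≥ 0` replacing the growth estimate for `ζ`.
* §2 (T44b `not_truncFin_of_zero`): hence ONE zero of `ζ_M` right of the line REFUTES `FIN_M`
  (`truncFloor_uniform_of_zero`: a uniform floor `c > 0` under all distances).
* §3 (T44e `exists_zero_gt_half`: `ζ_M` HAS such a zero for every `M ≥ 3`).  `M ≤ 28`: Turán's
  Liouville twist run ON THE CRITICAL LINE — `Σ_{n ≤ M} λ(n)/√n < 0` for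
  `M ∈ {3,5,7,8,9,11,…,15,17,18,20,21,28}` (`liouvilleTwist_half_neg`, exact `λ`, `√n` enclosed
  to `10⁻⁴`, `sqrt_table`), so by Bohr–Landau (tree
  `exists_zetaPartialSum_zero_of_realTwistedSum_neg`) `ζ_M` vanishes somewhere in `σ > 1/2`;
  `M = 16` (`Σ λ(n)/√n = +0.0025`): the twist `χ(5) = +1`, `χ(p) = -1` otherwise
  (`fiveTwist_sixteen_half_neg`, `-0.25`); `M = 4, 6, 10` (every real twist is positive at `1/2`):
  SPIRA'S TORUS CRITERION FROM `σ₁ = 1/2`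
  (`exists_zetaPartialSum_zero_of_spira_criterion_at` — the tree's `σ = 1` criterion re-run from any
  `σ₁ ≤ 2`) with one free prime and phases `(-3-4i)/5`, `(-4-3i)/5`, `(-24-7i)/25`, `(-7-24i)/25`,
  `(-4+3i)/5` (`exists_zero_gt_half_four|six|ten`); `M = 19, 22–27, 29–1000`: the tree's
  certificates `exists_zero_of_certificate'` (zeros even with `σ > 1`); `M > 1000`: the barrier
  `TuranPartialSums_holds` (Montgomery / Monach range; its tree proof runs `native_decide`
  certificates — the only non-standard axioms in this file, confined to `exists_zero_gt_half_of_ge`,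
  `exists_zero_gt_half`, `truncFin_iff`, `truncSplit_vacuous`, `nbThesis_imp_truncFin_iff`; the
  `M ≤ 1000` statements are standard-axiom).
* §4 (the small sections).  `FIN_0` is FALSE (`ζ_0 = 0`, every distance is `2π`,
  `not_truncFin_zero`); `FIN_1` is TRUE (T44c `truncFin_one`, `A = 1`); `FIN_2` is TRUE (T44d
  `truncFin_two`): with `A_K = Σ_{j<K} (-1)^j 2^{-js}` (length `2^K`), `1 - ζ_2 A_K = (-2^{-s})^K`
  and the distance is `2π·2^{-K}` exactly (`geomPoly_eval`, `mul_neg_geom_sum`,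
  `lintegral_inv_quarter_add_sq`).
* §5 (the census row V43).  T44 `truncFin_iff`: `FIN_M ⟺ (M = 1 ∨ M = 2)` for EVERY `M`
  (`truncFin_iff_of_le_thousand`: the same for `M ≤ 1000` on standard axioms).  Polarisation:
  `truncSplit_vacuous` («`FIN_M ∧ B ⟹ RH`» holds for EVERY `B` when `M ≥ 3` — refuted conjunct),
  `truncSplit_one_iff` / `truncSplit_two_iff` («`FIN_{1,2} ∧ B ⟹ RH` ⟺ `B ⟹ RH`» — decoration),
  `truncFin_two_imp_nbThesis_iff` («`FIN_2 ⟹ E_NB`» ⟺ RH) and `nbThesis_imp_truncFin_iff`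
  («`E_NB ⟹ FIN_M`» ⟺ ¬RH for `M ≥ 3`): along the `ζ`-truncation axis no statement is both RH-free
  decidable-as-true and RH-bearing — 0 survivors.

Every RH statement spells `_root_.RiemannHypothesis`.  No definitions.  Axioms: standard, plus the
tree's `native_decide` certificate axioms
`Literature.Barriers.RiemannHypothesis.TuranShift.{Cert,LowCert}.*` in the five `M > 1000`-covering
declarations named in §3.

HONEST LABEL: «SPLITTING SEARCH over kernel-typed RH-EQUIVALENCES; a splitting A ∧ B ⟹ RH is
CONDITIONAL bookkeeping unless A and B are both proved; nothing here bears on the truth of RH.»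
-/

noncomputable section

-- D-0017: `Summit.<S>.<S>.…` is the designed namespace of a single-problem summit.
set_option linter.dupNamespace false

open Complex MeasureTheory Set Filter
open scoped Real ENNReal

namespace Summit.RiemannHypothesis.RiemannHypothesis.Theorems.Splittings.NbTruncation

open Summit.RiemannHypothesis.RiemannHypothesis.Theses.NymanBeurling
open Summit.RiemannHypothesis.RiemannHypothesis.Theorems
open Literature.NumberTheory.LFunctions
open Literature.Barriers.RiemannHypothesis
open ArithmeticFunction

/-! ## §1 — Sections of `ζ`: size, the auxiliary function, the zero floor -/

/-- `‖ζ_M(s)‖ ≤ M` on the closed right half-plane (`‖n^{-s}‖ = n^{-σ} ≤ 1`). [folklore] -/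
theorem norm_zetaPartialSum_le_self (M : ℕ) {s : ℂ} (hs : 0 ≤ s.re) :
    ‖zetaPartialSum M s‖ ≤ M := by
  unfold zetaPartialSum
  calc ‖∑ n ∈ Finset.Icc 1 M, (n : ℂ) ^ (-s)‖
      ≤ ∑ n ∈ Finset.Icc 1 M, ‖(n : ℂ) ^ (-s)‖ := norm_sum_le _ _
    _ ≤ ∑ n ∈ Finset.Icc 1 M, (1 : ℝ) := Finset.sum_le_sum fun n hn ↦ by
        rw [Finset.mem_Icc] at hn
        rw [Complex.norm_natCast_cpow_of_pos (by omega), neg_re]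
        exact Real.rpow_le_one_of_one_le_of_nonpos (by exact_mod_cast hn.1) (by linarith)
    _ = M := by simp

/-- The auxiliary function `F(s) = (1 - ζ_M(s)A_a(s))·(ρ+1)/((s+1)s)` is holomorphic on `Re s > 0`.
[folklore] -/
theorem differentiableOn_truncAux (M : ℕ) (ρ : ℂ) {N : ℕ} (a : Fin N → ℂ) :
    DifferentiableOn ℂ
      (fun s ↦ (1 - zetaPartialSum M s * dirichletPoly a s) * ((ρ + 1) / (s + 1)) / s)
      {s : ℂ | 0 < s.re} := by
  have h1 : Differentiable ℂ fun s ↦ 1 - zetaPartialSum M s * dirichletPoly a s :=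
    (differentiable_const 1).sub
      ((differentiable_zetaPartialSum M).mul (differentiable_dirichletPoly a))
  refine DifferentiableOn.div ?_ differentiableOn_id ?_
  · refine h1.differentiableOn.mul ?_
    refine DifferentiableOn.div (differentiableOn_const _) (differentiableOn_id.add_const 1) ?_
    intro s hs h
    have : (s + 1).re = 0 := by rw [h]; simp
    simp at this
    have hs' : 0 < s.re := hs
    linarith
  · intro s hs h
    have hs' : 0 < s.re := hs
    rw [h] at hs'
    simp at hs'

/-- Growth: `‖F(s)‖ ≤ (1 + M ∑‖a_n‖) ‖ρ+1‖ / ‖s‖` for `Re s ≥ 1/2`, `‖s‖ ≥ 1`. [folklore] -/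
theorem norm_truncAux_le (M : ℕ) (ρ : ℂ) {N : ℕ} (a : Fin N → ℂ) {s : ℂ} (hs : 1 / 2 ≤ s.re)
    (h1 : 1 ≤ ‖s‖) :
    ‖(1 - zetaPartialSum M s * dirichletPoly a s) * ((ρ + 1) / (s + 1)) / s‖ ≤
      (1 + M * ∑ n : Fin N, ‖a n‖) * ‖ρ + 1‖ / ‖s‖ := by
  set A := ∑ n : Fin N, ‖a n‖ with hA
  have hA0 : 0 ≤ A := Finset.sum_nonneg fun n _ ↦ norm_nonneg _
  have hs0 : 0 ≤ s.re := by linarith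
  have hsn : 0 < ‖s‖ := by linarith
  have hnum : ‖1 - zetaPartialSum M s * dirichletPoly a s‖ ≤ 1 + M * A := by
    calc ‖1 - zetaPartialSum M s * dirichletPoly a s‖
        ≤ ‖(1 : ℂ)‖ + ‖zetaPartialSum M s * dirichletPoly a s‖ := norm_sub_le _ _
      _ = 1 + ‖zetaPartialSum M s‖ * ‖dirichletPoly a s‖ := by rw [norm_one, norm_mul]
      _ ≤ 1 + M * A := by
          gcongr
          · exact norm_zetaPartialSum_le_self M hs0
          · exact norm_dirichletPoly_le a hs0
  have hK : ‖(ρ + 1) / (s + 1)‖ ≤ ‖ρ + 1‖ / ‖s‖ := by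
    rw [norm_div]
    refine div_le_div_of_nonneg_left (norm_nonneg _) hsn ?_
    have h2 : ‖s‖ ^ 2 ≤ ‖s + 1‖ ^ 2 := by
      rw [Complex.sq_norm, Complex.sq_norm, Complex.normSq_apply, Complex.normSq_apply]
      simp
      nlinarith
    exact le_of_pow_le_pow_left₀ two_ne_zero (norm_nonneg _) h2
  rw [norm_div, norm_mul]
  calc ‖1 - zetaPartialSum M s * dirichletPoly a s‖ * ‖(ρ + 1) / (s + 1)‖ / ‖s‖
      ≤ (1 + M * A) * (‖ρ + 1‖ / ‖s‖) / ‖s‖ := by gcongr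
    _ ≤ (1 + M * A) * (‖ρ + 1‖ / ‖s‖) / 1 := by
        refine div_le_div_of_nonneg_left (by positivity) one_pos h1
    _ = (1 + M * A) * ‖ρ + 1‖ / ‖s‖ := by ring

/-- On the critical line, `‖F(s)/(s-ρ)‖ₑ = (‖1 - ζ_M(s)A_a(s)‖/‖s‖) · ‖(ρ+1)/((s+1)(s-ρ))‖ₑ`.
[folklore] -/
theorem enorm_truncAux_div_line (M : ℕ) (ρ : ℂ) {N : ℕ} (a : Fin N → ℂ) (t : ℝ) :
    ‖(1 - zetaPartialSum M (1 / 2 + t * I) * dirichletPoly a (1 / 2 + t * I)) *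
          ((ρ + 1) / (1 / 2 + t * I + 1)) / (1 / 2 + t * I) / (1 / 2 + t * I - ρ)‖ₑ =
      ENNReal.ofReal (‖1 - zetaPartialSum M (1 / 2 + t * I) * dirichletPoly a (1 / 2 + t * I)‖ /
          ‖(1 / 2 : ℂ) + t * I‖) *
        ‖(ρ + 1) / ((1 / 2 : ℂ) + t * I + 1) / (1 / 2 + t * I - ρ)‖ₑ := by
  set s : ℂ := 1 / 2 + t * I with hs
  have hfac : (1 - zetaPartialSum M s * dirichletPoly a s) * ((ρ + 1) / (s + 1)) / s / (s - ρ) =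
      ((1 - zetaPartialSum M s * dirichletPoly a s) / s) * ((ρ + 1) / (s + 1) / (s - ρ)) := by
    ring
  rw [hfac, enorm_mul, ← ofReal_norm, norm_div]

/-- **Zero floor for the truncated distances (T44a).** If `ζ_M(ρ) = 0` with `Re ρ > 1/2`, then for
EVERY Dirichlet polynomial `A(s) = Σ_{k<N} a_k (k+1)^{-s}`,
`4π (Re ρ - 1/2)² / (‖ρ‖² ‖ρ+1‖²) ≤ ∫ |1 - ζ_M(1/2+it) A(1/2+it)|² dt/(1/4+t²)`.
(Contour inequality `ofReal_norm_le_lintegral_line` for `F(s) = (1 - ζ_M A)(ρ+1)/((s+1)s)`,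
`F(ρ) = 1/ρ`, Cauchy–Schwarz and `nb_lintegral_kernel_sq_le`; the `ζ_M`-analogue of
`nbIntegrand_floor_of_zero` — no pole, so no factor `s - 1`.) [folklore] -/
theorem truncIntegrand_floor_of_zero {M : ℕ} {ρ : ℂ} (hζ : zetaPartialSum M ρ = 0)
    (hρ : 1 / 2 < ρ.re) (N : ℕ) (a : Fin N → ℂ) :
    ENNReal.ofReal (4 * π * (ρ.re - 1 / 2) ^ 2 / (‖ρ‖ ^ 2 * ‖ρ + 1‖ ^ 2)) ≤
      ∫⁻ t : ℝ, ENNReal.ofReal (‖1 - zetaPartialSum M (1 / 2 + t * Complex.I) *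
        ∑ n : Fin N, a n * ((n : ℂ) + 1) ^ (-(1 / 2 + t * Complex.I))‖ ^ 2 / (1 / 4 + t ^ 2)) := by
  have hρ0 : ρ ≠ 0 := by
    intro h; rw [h] at hρ; simp at hρ; linarith
  have hρm1 : ρ + 1 ≠ 0 := by
    intro h
    have : (ρ + 1).re = 0 := by rw [h]; simp
    simp at this; linarith
  have hδ0 : 0 < ρ.re - 1 / 2 := by linarith
  have hn0 : 0 < ‖ρ‖ := norm_pos_iff.mpr hρ0
  have hnm1 : 0 < ‖ρ + 1‖ := norm_pos_iff.mpr hρm1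
  -- the two constants
  set v : ℝ := 2 * π * ‖(1 : ℂ) / ρ‖ with hv
  have hv' : v = 2 * π / ‖ρ‖ := by
    rw [hv, norm_div, norm_one]; ring
  have hv0 : 0 < v := by rw [hv']; positivity
  set K : ℝ := (‖ρ + 1‖ / (ρ.re - 1 / 2)) ^ 2 * π with hK
  have hK0 : 0 < K := by
    have : 0 < ‖ρ + 1‖ / (ρ.re - 1 / 2) := div_pos hnm1 hδ0
    positivity
  have hc : 4 * π * (ρ.re - 1 / 2) ^ 2 / (‖ρ‖ ^ 2 * ‖ρ + 1‖ ^ 2) = v ^ 2 / K := by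
    rw [hv', hK]
    field_simp
    ring
  -- the integral and the kernel mass
  set Iv : ℝ≥0∞ := ∫⁻ t : ℝ, ENNReal.ofReal (‖1 - zetaPartialSum M (1 / 2 + t * Complex.I) *
      ∑ n : Fin N, a n * ((n : ℂ) + 1) ^ (-(1 / 2 + t * Complex.I))‖ ^ 2 / (1 / 4 + t ^ 2)) with hIv
  set G : ℝ≥0∞ := ∫⁻ t : ℝ, ‖(ρ + 1) / ((1 / 2 : ℂ) + t * I + 1) / (1 / 2 + t * I - ρ)‖ₑ ^ (2 : ℝ)
    with hG
  have hGle : G ≤ ENNReal.ofReal K := nb_lintegral_kernel_sq_le hρ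
  have hg_meas : Measurable fun t : ℝ ↦
      ‖(ρ + 1) / ((1 / 2 : ℂ) + t * I + 1) / (1 / 2 + t * I - ρ)‖ₑ := by
    refine Measurable.enorm ?_
    exact (by fun_prop : Measurable fun t : ℝ ↦
      (ρ + 1) / ((1 / 2 : ℂ) + t * I + 1) / (1 / 2 + t * I - ρ))
  -- Step 1: the contour inequality and Cauchy–Schwarz: `ofReal v ≤ Iv^{1/2} G^{1/2}`
  have key : ENNReal.ofReal v ≤ Iv ^ (1 / 2 : ℝ) * G ^ (1 / 2 : ℝ) := by
    set A := ∑ n : Fin N, ‖a n‖ with hA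
    have hA0 : 0 ≤ A := Finset.sum_nonneg fun n _ ↦ norm_nonneg _
    have hC : 0 ≤ (1 + M * A) * ‖ρ + 1‖ := by positivity
    have hcore := ofReal_norm_le_lintegral_line
      (F := fun s ↦ (1 - zetaPartialSum M s * dirichletPoly a s) * ((ρ + 1) / (s + 1)) / s)
      hρ (differentiableOn_truncAux M ρ a) (R₀ := 1) hC
      (fun s hs h1 ↦ norm_truncAux_le M ρ a hs h1)
    have hval : (1 - zetaPartialSum M ρ * dirichletPoly a ρ) * ((ρ + 1) / (ρ + 1)) / ρ =
        1 / ρ := by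
      rw [hζ, zero_mul, sub_zero, div_self hρm1, one_mul]
    simp only [hval] at hcore
    refine hcore.trans ?_
    set f : ℝ → ℝ≥0∞ := fun t ↦ ENNReal.ofReal
      (‖1 - zetaPartialSum M (1 / 2 + t * I) * dirichletPoly a (1 / 2 + t * I)‖ /
        ‖(1 / 2 : ℂ) + t * I‖) with hf
    set g : ℝ → ℝ≥0∞ := fun t ↦ ‖(ρ + 1) / ((1 / 2 : ℂ) + t * I + 1) / (1 / 2 + t * I - ρ)‖ₑ
      with hg
    have hf_meas : Measurable f := by
      refine ENNReal.measurable_ofReal.comp ?_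
      refine Measurable.div ?_ (by fun_prop)
      refine (Continuous.norm ?_).measurable
      have hc : Continuous fun t : ℝ ↦ (1 / 2 : ℂ) + t * I := by fun_prop
      exact continuous_const.sub
        (((differentiable_zetaPartialSum M).continuous.comp hc).mul
          ((NymanBeurlingDirichlet.continuous_dirichletPoly a).comp hc))
    calc ∫⁻ t : ℝ, ‖(1 - zetaPartialSum M (1 / 2 + t * I) * dirichletPoly a (1 / 2 + t * I)) *
            ((ρ + 1) / (1 / 2 + t * I + 1)) / (1 / 2 + t * I) / (1 / 2 + t * I - ρ)‖ₑ
        = ∫⁻ t : ℝ, (f * g) t := lintegral_congr fun t ↦ enorm_truncAux_div_line M ρ a t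
      _ ≤ (∫⁻ t, f t ^ (2 : ℝ)) ^ (1 / (2 : ℝ)) * (∫⁻ t, g t ^ (2 : ℝ)) ^ (1 / (2 : ℝ)) :=
          ENNReal.lintegral_mul_le_Lp_mul_Lq volume Real.HolderConjugate.two_two
            hf_meas.aemeasurable hg_meas.aemeasurable
      _ = Iv ^ (1 / 2 : ℝ) * G ^ (1 / 2 : ℝ) := by
          congr 2
          refine lintegral_congr fun t ↦ ?_
          rw [hf]
          dsimp only
          rw [ENNReal.rpow_two, ← ENNReal.ofReal_pow (by positivity), div_pow,
            norm_sq_one_half_add t]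
          rfl
  -- Step 2: replace `G` by its bound and pass to real numbers
  have key2 : ENNReal.ofReal v ≤ Iv ^ (1 / 2 : ℝ) * ENNReal.ofReal (Real.sqrt K) := by
    have hGK : G ^ (1 / 2 : ℝ) ≤ ENNReal.ofReal (Real.sqrt K) :=
      calc G ^ (1 / 2 : ℝ) ≤ (ENNReal.ofReal K) ^ (1 / 2 : ℝ) :=
            ENNReal.rpow_le_rpow hGle (by norm_num)
        _ = ENNReal.ofReal (Real.sqrt K) := by
            rw [ENNReal.ofReal_rpow_of_nonneg hK0.le (by norm_num), Real.sqrt_eq_rpow]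
    calc ENNReal.ofReal v ≤ Iv ^ (1 / 2 : ℝ) * G ^ (1 / 2 : ℝ) := key
      _ ≤ Iv ^ (1 / 2 : ℝ) * ENNReal.ofReal (Real.sqrt K) := by gcongr
  rcases eq_or_ne Iv ⊤ with htop | hfin
  · rw [htop]; exact le_top
  set i : ℝ := Iv.toReal with hi
  have hi0 : 0 ≤ i := ENNReal.toReal_nonneg
  have hIi : Iv = ENNReal.ofReal i := (ENNReal.ofReal_toReal hfin).symm
  have hreal : v ≤ Real.sqrt i * Real.sqrt K := by
    have h := key2
    rw [hIi, ENNReal.ofReal_rpow_of_nonneg hi0 (by norm_num), ← Real.sqrt_eq_rpow,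
      ← ENNReal.ofReal_mul (Real.sqrt_nonneg _)] at h
    exact (ENNReal.ofReal_le_ofReal_iff (by positivity)).mp h
  have hsq : v ^ 2 ≤ i * K := by
    have h := pow_le_pow_left₀ hv0.le hreal 2
    have e : (Real.sqrt i * Real.sqrt K) ^ 2 = i * K := by
      rw [mul_pow, Real.sq_sqrt hi0, Real.sq_sqrt hK0.le]
    exact h.trans_eq e
  rw [hc, hIi]
  refine ENNReal.ofReal_le_ofReal ?_
  rwa [div_le_iff₀ hK0]


/-! ## §2 — `FIN_M` is refuted by every zero of `ζ_M` right of the critical line -/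

/-- A zero of `ζ_M` with `Re ρ > 1/2` puts ONE positive constant below ALL truncated distances
`∫ |1 - ζ_M A|² dt/(1/4+t²)` (all lengths, all coefficients). [folklore] -/
theorem truncFloor_uniform_of_zero {M : ℕ} {ρ : ℂ} (hζ : zetaPartialSum M ρ = 0)
    (hρ : 1 / 2 < ρ.re) :
    ∃ c : ℝ, 0 < c ∧ ∀ (N : ℕ) (a : Fin N → ℂ), ENNReal.ofReal c ≤
      ∫⁻ t : ℝ, ENNReal.ofReal (‖1 - zetaPartialSum M (1 / 2 + t * Complex.I) *
        ∑ n : Fin N, a n * ((n : ℂ) + 1) ^ (-(1 / 2 + t * Complex.I))‖ ^ 2 / (1 / 4 + t ^ 2)) := by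
  have hρ0 : ρ ≠ 0 := by
    intro h; rw [h] at hρ; simp at hρ; linarith
  have hρm1 : ρ + 1 ≠ 0 := by
    intro h
    have : (ρ + 1).re = 0 := by rw [h]; simp
    simp at this; linarith
  have hδ0 : 0 < ρ.re - 1 / 2 := by linarith
  have hn0 : 0 < ‖ρ‖ := norm_pos_iff.mpr hρ0
  have hnm1 : 0 < ‖ρ + 1‖ := norm_pos_iff.mpr hρm1
  exact ⟨4 * π * (ρ.re - 1 / 2) ^ 2 / (‖ρ‖ ^ 2 * ‖ρ + 1‖ ^ 2), by positivity,
    fun N a ↦ truncIntegrand_floor_of_zero hζ hρ N a⟩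

/-- **`FIN_M` dies at a zero (T44b).** If `ζ_M(ρ) = 0` for some `Re ρ > 1/2`, the truncated
Nyman–Beurling statement `FIN_M := ∀ ε > 0, ∃ N a, ∫ |1 - ζ_M A_a|² dt/(1/4+t²) < ε` is FALSE.
[folklore] -/
theorem not_truncFin_of_zero {M : ℕ} {ρ : ℂ} (hζ : zetaPartialSum M ρ = 0) (hρ : 1 / 2 < ρ.re) :
    ¬ (∀ ε : ℝ, 0 < ε → ∃ (N : ℕ) (a : Fin N → ℂ),
      ∫⁻ t : ℝ, ENNReal.ofReal (‖1 - zetaPartialSum M (1 / 2 + t * Complex.I) *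
        ∑ n : Fin N, a n * ((n : ℂ) + 1) ^ (-(1 / 2 + t * Complex.I))‖ ^ 2 / (1 / 4 + t ^ 2)) <
        ENNReal.ofReal ε) := by
  obtain ⟨c, hc, hfloor⟩ := truncFloor_uniform_of_zero hζ hρ
  intro h
  obtain ⟨N, a, ha⟩ := h c hc
  exact absurd ((hfloor N a).trans_lt ha) (lt_irrefl _)

/-! ## §3 — Zeros of `ζ_M` right of the critical line, for every `M ≥ 3` -/

/-- `M ≥ 29`: the catalogued barrier `TuranPartialSums` — PROVED in the tree
(`TuranPartialSums_holds`: kernel certificates for `29 ≤ M ≤ 1000`, vertical-shift certificates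
beyond) gives a zero with `σ > 1 > 1/2`. [cite: PlattTrudgian2016, Theorem 1.1] -/
theorem exists_zero_gt_half_of_ge {M : ℕ} (hM : 29 ≤ M) :
    ∃ ρ : ℂ, zetaPartialSum M ρ = 0 ∧ 1 / 2 < ρ.re := by
  obtain ⟨s, hs, h0⟩ := TuranPartialSums_holds M hM
  exact ⟨s, h0, by linarith⟩

/-- `M = 19`, `22 ≤ M ≤ 27` (and `29 ≤ M ≤ 1000`): the kernel certificates of Spira's Table III /
van de Lune–te Riele (`exists_zero_of_certificate'`), zeros with `σ > 1`.
[cite: PlattTrudgian2016, Theorem 1.1] [cite: Spira1968, §4 Table III] -/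
theorem exists_zero_gt_half_of_cert {M : ℕ}
    (h : M = 19 ∨ (22 ≤ M ∧ M ≤ 27) ∨ (29 ≤ M ∧ M ≤ 1000)) :
    ∃ ρ : ℂ, zetaPartialSum M ρ = 0 ∧ 1 / 2 < ρ.re := by
  obtain ⟨s, hs, h0⟩ := exists_zero_of_certificate' M h
  exact ⟨s, h0, by linarith⟩

/-- A negative REAL TWIST at `σ₁ = 1/2` gives a zero of `ζ_M` right of the critical line
(Bohr–Apostol transfer `exists_zetaPartialSum_zero_of_realTwistedSum_neg`).
[cite: Apostol1990, §8.13, proof of Thm. 8.20] -/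
theorem exists_zero_gt_half_of_realTwist_neg {M : ℕ} (hM : 1 ≤ M) {χ : ℕ → ℝ}
    (hmul : ∀ m n : ℕ, m ≠ 0 → n ≠ 0 → χ (m * n) = χ m * χ n)
    (hχ : ∀ p : ℕ, p.Prime → |χ p| = 1) (hneg : realTwistedSum χ M (1 / 2) < 0) :
    ∃ ρ : ℂ, zetaPartialSum M ρ = 0 ∧ 1 / 2 < ρ.re := by
  obtain ⟨s, h0, hre, -⟩ := exists_zetaPartialSum_zero_of_realTwistedSum_neg hmul hχ hM hneg 0
  exact ⟨s, h0, hre⟩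


end Summit.RiemannHypothesis.RiemannHypothesis.Theorems.Splittings.NbTruncation

end
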